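import Literature.NumberTheory.LFunctions.WeilExplicitDirichlet
import Literature.NumberTheory.LFunctions.WeilArchimedeanPositivityHolds
import HarnessLib

/-!
# GRH arm (rh-explicit, venture WeilGRH): the base rung for even characters, `WeilPositivityOnChar χ ((log 2)/2)`

For every Dirichlet character `χ` of modulus `q ≥ 5` with `χ(-1) = 1`, Weil's twisted quadratic
functional `Q_χ(g) = W_χ(g ⋆ g̃)` (`Literature.NumberTheory.LFunctions.weilQuadraticChar`, the
digamma normalisation of `WeilExplicitDirichlet.lean`) is non-negative on every smooth `g`
supported in `[-(log 2)/2, (log 2)/2]`: the first rung of the Weil support-extension ladder holds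
for the whole family at once (rh-explicit GRH arm, TRANSFER certificate, base rung).

## Proof (transfer from the `ζ` rung R1, no new analysis)

On the window no prime enters (`weilQuadraticChar_eq_arch_of_tsupport_subset`), so with
`k = g ⋆ g̃`, `N = ‖g‖₂² = k(0)` and `A = ∫ |ĝ(1/2+it)|² Re ψ(1/4 + it/2) dt`,
`Re Q_χ(g) = A/(2π) + N (log q - log π)`, while Yoshida's theorem for `ζ`
(`weilArchQuadratic_nonneg`, kernel-checked certificate) reads `P - N log π + A/(2π) ≥ 0` with the
polar term `P = 2 Re(ĝ(0) conj ĝ(1))`. Writing `ĝ(1) = c + s`, `ĝ(0) = c - s` with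
`c = ∫ g cosh(x/2)`, `s = ∫ g sinh(x/2)` gives `P = 2|c|² - 2|s|² ≤ 2|c|² ≤ 2 (sinh a + a) N` by
Cauchy–Schwarz (`∫_{-a}^{a} cosh²(x/2) dx = sinh a + a`), and at `a = (log 2)/2`,
`2 (sinh a + a) = 1/√2 + log 2 < 3/2 < log 5 ≤ log q`. Hence
`Re Q_χ(g) ≥ N (log q - 2(sinh a + a)) ≥ 0`.

## References

* A. Weil, *Sur les "formules explicites" de la théorie des nombres premiers* (1952), (11) and the
  «lemme» p. 262 (the functional and its positivity criterion for `L(s, χ)`).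
* H. Yoshida, *On Hermitian forms attached to zeta functions* (1992), Theorem 1 and (6.2)–(6.3)
  (the `ζ` rung at `(log 2)/2` and the polar-term bookkeeping `ĝ(1), ĝ(0) = c ± s`).
-/

noncomputable section

open Complex Filter Set MeasureTheory
open scoped Real Topology ComplexConjugate

namespace Summit.Ventures.WeilGRH

open Literature.NumberTheory.LFunctions

/-- `∫_{-a}^{a} cosh²(x/2) dx = sinh a + a` for `a ≥ 0` (the primitive of `cosh²(x/2) = (cosh x + 1)/2`
is `(sinh x + x)/2`). [folklore] -/
theorem integral_Icc_cosh_half_sq {a : ℝ} (ha : 0 ≤ a) :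
    ∫ x in Icc (-a) a, Real.cosh (x / 2) ^ 2 = Real.sinh a + a := by
  rw [integral_Icc_eq_integral_Ioc, ← intervalIntegral.integral_of_le (by linarith)]
  have hderiv : ∀ x ∈ uIcc (-a) a,
      HasDerivAt (fun x ↦ (Real.sinh x + x) / 2) (Real.cosh (x / 2) ^ 2) x := by
    intro x _
    have h1 : HasDerivAt (fun x ↦ (Real.sinh x + x) / 2) ((Real.cosh x + 1) / 2) x :=
      ((Real.hasDerivAt_sinh x).add (hasDerivAt_id x)).div_const 2
    convert h1 using 1
    have h2 := Real.cosh_add (x / 2) (x / 2)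
    rw [add_halves] at h2
    nlinarith [Real.cosh_sq (x / 2)]
  rw [intervalIntegral.integral_eq_sub_of_hasDerivAt hderiv
    ((by fun_prop : Continuous fun x ↦ Real.cosh (x / 2) ^ 2).intervalIntegrable _ _)]
  simp only [Real.sinh_neg]
  ring

/-- **Upper bound for the polar term** (companion of `Yoshida1992_polar_lower_bound`): for a test
function `g` with `tsupport g ⊆ [-a, a]`,
`2 Re(ĝ(0) conj ĝ(1)) ≤ 2 (sinh a + a) ‖g‖₂²`.
With `c = ∫ g(x) cosh(x/2) dx`, `s = ∫ g(x) sinh(x/2) dx` one has `ĝ(1) = c + s`, `ĝ(0) = c - s`,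
`2 Re(ĝ(0) conj ĝ(1)) = 2|c|² - 2|s|² ≤ 2|c|²`, and `|c|² ≤ ‖g‖₂² ∫_{-a}^{a} cosh²(x/2) dx` by
Cauchy–Schwarz. [cite: Yoshida1992, §6 eq. (6.2) (polar term as 2ε|∫φ e^{x/2}|²; here parity-free, upper side)] -/
theorem weilPolar_re_le {g : ℝ → ℂ} (hg : IsWeilTest g) {a : ℝ}
    (hsupp : tsupport g ⊆ Icc (-a) a) :
    2 * (weilMellin g 0 * conj (weilMellin g 1)).re ≤
      2 * (Real.sinh a + a) * ∫ t : ℝ, ‖g t‖ ^ 2 := by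
  rcases lt_or_ge a 0 with ha | ha
  · -- empty cone: `g = 0`
    have hg0 : g = 0 := by
      rw [← tsupport_eq_empty_iff]
      exact eq_empty_of_subset_empty (hsupp.trans (by rw [Icc_eq_empty (by linarith)]))
    subst hg0
    simp [weilMellin]
  have hgi : ∀ φ : ℝ → ℝ, Continuous φ → Integrable fun x ↦ g x * (φ x : ℂ) := fun φ hφ ↦
    (hg.1.continuous.mul (continuous_ofReal.comp hφ)).integrable_of_hasCompactSupport
      hg.2.mul_right
  set c : ℂ := ∫ x : ℝ, g x * (Real.cosh (x / 2) : ℂ) with hc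
  set s : ℂ := ∫ x : ℝ, g x * (Real.sinh (x / 2) : ℂ) with hs
  have h1 : weilMellin g 1 = c + s := by
    unfold weilMellin
    rw [hc, hs, ← integral_add (hgi _ (by fun_prop)) (hgi _ (by fun_prop))]
    congr 1 with x
    have : cexp ((1 - 1 / 2) * (x : ℂ)) = (Real.cosh (x / 2) : ℂ) + (Real.sinh (x / 2) : ℂ) := by
      rw [← Complex.ofReal_add, Real.cosh_add_sinh, Complex.ofReal_exp]
      congr 1
      push_cast
      ring
    rw [this]
    ring
  have h0 : weilMellin g 0 = c - s := by
    unfold weilMellin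
    rw [hc, hs, ← integral_sub (hgi _ (by fun_prop)) (hgi _ (by fun_prop))]
    congr 1 with x
    have : cexp ((0 - 1 / 2) * (x : ℂ)) = (Real.cosh (x / 2) : ℂ) - (Real.sinh (x / 2) : ℂ) := by
      rw [← Complex.ofReal_sub, Real.cosh_sub_sinh, Complex.ofReal_exp]
      congr 1
      push_cast
      ring
    rw [this]
    ring
  have hre : (weilMellin g 0 * conj (weilMellin g 1)).re = ‖c‖ ^ 2 - ‖s‖ ^ 2 := by
    rw [h0, h1, ← Complex.normSq_eq_norm_sq, ← Complex.normSq_eq_norm_sq, Complex.normSq_apply,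
      Complex.normSq_apply]
    simp only [mul_re, sub_re, sub_im, map_add, add_re, add_im, conj_re, conj_im]
    ring
  -- Cauchy–Schwarz for `c`
  have hc_bound : ‖c‖ ^ 2 ≤ (Real.sinh a + a) * ∫ t : ℝ, ‖g t‖ ^ 2 := by
    have hzero : ∀ x, x ∉ Icc (-a) a → g x = 0 := fun x hx ↦
      image_eq_zero_of_notMem_tsupport fun h ↦ hx (hsupp h)
    have hcI : c = ∫ x in Icc (-a) a, g x * (Real.cosh (x / 2) : ℂ) := by
      rw [hc, setIntegral_eq_integral_of_forall_compl_eq_zero]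
      intro x hx
      simp [hzero x hx]
    have hNI : ∫ t : ℝ, ‖g t‖ ^ 2 = ∫ t in Icc (-a) a, ‖g t‖ ^ 2 := by
      rw [setIntegral_eq_integral_of_forall_compl_eq_zero]
      intro x hx
      simp [hzero x hx]
    have hle : ‖c‖ ≤ ∫ x in Icc (-a) a, ‖g x‖ * |Real.cosh (x / 2)| := by
      rw [hcI]
      refine (norm_integral_le_integral_norm _).trans (le_of_eq ?_)
      congr 1 with x
      rw [norm_mul, Complex.norm_real, Real.norm_eq_abs]
    have hf2 : MemLp (fun x ↦ ‖g x‖) (ENNReal.ofReal 2) (volume.restrict (Icc (-a) a)) := by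
      rw [ENNReal.ofReal_ofNat, memLp_two_iff_integrable_sq
        (hg.1.continuous.norm.aestronglyMeasurable)]
      exact ((hg.1.continuous.norm.pow 2).integrableOn_Icc)
    have hk2 : MemLp (fun x ↦ |Real.cosh (x / 2)|) (ENNReal.ofReal 2)
        (volume.restrict (Icc (-a) a)) := by
      have hk : Continuous fun x ↦ |Real.cosh (x / 2)| := by fun_prop
      rw [ENNReal.ofReal_ofNat, memLp_two_iff_integrable_sq hk.aestronglyMeasurable]
      exact (hk.pow 2).integrableOn_Icc
    have hCS := integral_mul_le_Lp_mul_Lq_of_nonneg Real.HolderConjugate.two_two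
      (Eventually.of_forall fun x ↦ norm_nonneg (g x))
      (Eventually.of_forall fun x ↦ abs_nonneg (Real.cosh (x / 2))) hf2 hk2
    simp only [Real.rpow_two, sq_abs] at hCS
    rw [integral_Icc_cosh_half_sq ha] at hCS
    have hA : 0 ≤ ∫ x in Icc (-a) a, ‖g x‖ ^ 2 := integral_nonneg fun x ↦ by positivity
    have hB : 0 ≤ Real.sinh a + a := by
      have := Real.self_le_sinh_iff.2 ha
      linarith
    have hprod : ((∫ x in Icc (-a) a, ‖g x‖ ^ 2) ^ (1 / 2 : ℝ) *
        (Real.sinh a + a) ^ (1 / 2 : ℝ)) ^ 2 =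
        (∫ x in Icc (-a) a, ‖g x‖ ^ 2) * (Real.sinh a + a) := by
      rw [mul_pow, ← Real.rpow_natCast, ← Real.rpow_natCast, ← Real.rpow_mul hA,
        ← Real.rpow_mul hB]
      norm_num
    calc ‖c‖ ^ 2 ≤ (∫ x in Icc (-a) a, ‖g x‖ * |Real.cosh (x / 2)|) ^ 2 :=
          pow_le_pow_left₀ (norm_nonneg _) hle 2
      _ ≤ ((∫ x in Icc (-a) a, ‖g x‖ ^ 2) ^ (1 / 2 : ℝ) * (Real.sinh a + a) ^ (1 / 2 : ℝ)) ^ 2 :=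
          pow_le_pow_left₀ (integral_nonneg fun x ↦ by positivity) hCS 2
      _ = (Real.sinh a + a) * ∫ t : ℝ, ‖g t‖ ^ 2 := by rw [hprod, hNI, mul_comm]
  rw [hre]
  nlinarith [sq_nonneg ‖s‖, hc_bound]

/-- `2 (sinh((log 2)/2) + (log 2)/2) = 1/√2 + log 2` (`e^{(log 2)/2} = √2`). [folklore] -/
theorem two_mul_sinh_log_two_half_add :
    2 * (Real.sinh (Real.log 2 / 2) + Real.log 2 / 2) = 1 / Real.sqrt 2 + Real.log 2 := by
  have h := two_mul_sinh_log_two_half_sub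
  linarith

/-- The numerical inequality behind the transfer at the base rung: `1/√2 + log 2 < log 5`
(`1/√2 < 0.7072`, `log 2 < 0.6931471808`, and `log 5 > 3/2` since `e³ < 25`). [folklore] -/
theorem inv_sqrt_two_add_log_two_lt_log_five :
    1 / Real.sqrt 2 + Real.log 2 < Real.log 5 := by
  -- `1/√2 < 0.7072`
  have hs2 : (1.4142 : ℝ) < Real.sqrt 2 := by
    rw [show (1.4142 : ℝ) = Real.sqrt (1.4142 ^ 2) by rw [Real.sqrt_sq (by norm_num)]]
    exact Real.sqrt_lt_sqrt (by norm_num) (by norm_num)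
  have h1 : 1 / Real.sqrt 2 < 0.7072 := by
    rw [div_lt_iff₀ (by positivity)]
    nlinarith
  -- `log 2 < 0.6931471808`
  have h2 : Real.log 2 < 0.6931471808 := Real.log_two_lt_d9
  -- `log 5 > 3/2`: `exp (3/2) < 5` since `exp 3 = (exp 1)^3 < 2.7182818286^3 < 25`
  have he : Real.exp 1 < 2.7182818286 := Real.exp_one_lt_d9
  have he3 : Real.exp 3 < 25 := by
    have : Real.exp 3 = Real.exp 1 ^ 3 := by
      rw [← Real.exp_nat_mul]; norm_num
    rw [this]
    have h0 : 0 < Real.exp 1 := Real.exp_pos 1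
    nlinarith [mul_pos h0 h0]
  have h32 : Real.exp (3 / 2) < 5 := by
    have hsq : Real.exp (3 / 2) ^ 2 = Real.exp 3 := by
      rw [← Real.exp_nat_mul]; norm_num
    nlinarith [Real.exp_pos (3 / 2 : ℝ)]
  have h3 : (3 / 2 : ℝ) < Real.log 5 := by
    rw [Real.lt_log_iff_exp_lt (by norm_num)]
    exact h32
  linarith

variable {q : ℕ}

/-- **The base rung of the GRH arm for even characters.** For every Dirichlet character `χ`
mod `q ≥ 5` with `χ(-1) = 1`, Weil positivity holds on `[-(log 2)/2, (log 2)/2]`: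
`Re W_χ(g ⋆ g̃) ≥ 0` for every smooth `g` supported there. Transfer from the `ζ` rung
(`weilArchQuadratic_nonneg`, Yoshida's Theorem 1 at `(log 2)/2`): on the prime-free window
`Re Q_χ(g) = E(g) - 2 Re(ĝ(0) conj ĝ(1)) + (log q) ‖g‖₂²` with `E(g) ≥ 0` and
`2 Re(ĝ(0) conj ĝ(1)) ≤ (1/√2 + log 2) ‖g‖₂² < (log 5) ‖g‖₂²`. (For primitive `χ` this is the
case `t = (log 2)/2` of the `GRH(χ)`-equivalent family `WeilPositivityOnChar χ t`; the statement
holds for imprimitive even `χ` as well, the functional being the same expression.)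
[cite: Weil1952FormulesExplicites, (11) pp. 261–262 and the «lemme» p. 262; Yoshida1992, Thm 1 (§6 p. 310)] -/
theorem weilPositivityOnChar_log_two_half_of_even (hq : 5 ≤ q) (χ : DirichletCharacter ℂ q)
    (hχ : χ.Even) : WeilPositivityOnChar χ (Real.log 2 / 2) := by
  intro g hg hsupp
  have hq1 : q ≠ 1 := by omega
  set N : ℝ := ∫ t : ℝ, ‖g t‖ ^ 2 with hN
  set A : ℝ := ∫ t : ℝ, ‖weilMellin g (1 / 2 + t * I)‖ ^ 2 *
      (Complex.digamma (1 / 4 + t / 2 * I)).re with hA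
  set P : ℝ := 2 * (weilMellin g 0 * conj (weilMellin g 1)).re with hP
  -- the twisted functional on the prime-free window
  have hQ : weilQuadraticChar χ g =
      ((1 / (2 * π) * A + N * (Real.log q - Real.log π) : ℝ) : ℂ) := by
    rw [weilQuadraticChar_eq_arch_of_tsupport_subset hq1 hg hsupp (by linarith),
      charParity_of_even hχ]
    unfold weilArchTermChar
    rw [weilArchIntegralChar_zero, weilArchIntegral_weilConv_weilReflect hg,
      weilConv_weilReflect_apply_zero]
    push_cast
    ring
  -- the `ζ` rung (Yoshida's theorem, kernel-checked certificate in the tree)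
  have hE : 0 ≤ weilArchQuadratic g := weilArchQuadratic_nonneg hg hsupp
  rw [weilArchQuadratic_eq] at hE
  -- the polar term is at most `(1/√2 + log 2) N`
  have hPle : P ≤ (1 / Real.sqrt 2 + Real.log 2) * N := by
    have h := weilPolar_re_le hg hsupp
    rw [two_mul_sinh_log_two_half_add] at h
    exact h
  have hN0 : 0 ≤ N := integral_nonneg fun t ↦ by positivity
  have hlogq : Real.log 5 ≤ Real.log q :=
    Real.log_le_log (by norm_num) (by exact_mod_cast hq)
  have hnum := inv_sqrt_two_add_log_two_lt_log_five
  rw [hQ, Complex.ofReal_re]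
  change 0 ≤ 2 * (weilMellin g 0 * conj (weilMellin g 1)).re - Real.log π * N +
    1 / (2 * π) * A at hE
  nlinarith [mul_le_mul_of_nonneg_right hlogq hN0, mul_nonneg hN0 (sub_nonneg.2 hlogq)]

end Summit.Ventures.WeilGRH
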